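import Summits.KontsevichZagierPeriods.KontsevichZagierPeriods.Theorems.LinRedNormalFormArrangementNormalFormSeparateThreePiece

/-!
# Ratio conditions make every family of poles unblocked
(stub `stub_separateHigh`, part `KUnblocked`)

(Line `janus-bands`, crux `ArrangementNormalForm`, stub `stub_separateHigh` — separation in base
dimension `3` WITH `k` fibres, `JJ 3 k → closure (GG 2 1 k)`; part `KUnblocked`: the
combinatorial input `hunb` of the contact-aware engine `SepThree.sepC_induction`, in EVERY base
dimension `b + 1` with `k` fibres, WITHOUT thinness, special points, grids or cancellations.)

**Lemma** (`SepThreeK.hunb_of_ratio`). On a cell `σ = gDom b k …` let `y = λ_j(x')` (`j ∈ act`)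
be pole planes which do not meet `σ` and satisfy the RATIO condition
`|y − λ_{j'}| ≤ C |λ_j − λ_{j'}|` on `σ` for every pair of `act`-poles with `λ_j ≠ λ_{j'}` (this is
exactly what the fan lemma `separateHigh_fan_active` delivers). Then every `S ⊆ act` containing
two distinct poles contains a SPLITTABLE pair `(i, i')`: every point of the closed cell on both
planes `H_i`, `H_{i'}` lies on every `H_j`, `j ∈ S`.

Proof. By the ratio condition and the non-vanishing, the resultant `λ_j − λ_{j'}` of two distinct
`act`-poles does not vanish on the convex cell, so it has a constant sign there and a weak sign
on the closure (`SepThreeK.sign_of_ratio`). Take a distinct pair `(i, i')` of `S` with minimal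
contact `T_{ii'} = H_i ∩ H_{i'} ∩ σ̄`; if `z ∈ T_{ii'} ∖ H_j` (`j ∈ S`), minimality gives
`a ∈ T_{ij} ∖ H_{i'}` and `c ∈ T_{i'j} ∖ H_i`; with `f = λ_i − λ_{i'}`, `g = λ_{i'} − λ_j`,
`f + g = λ_i − λ_j`: `f(z) = 0 ≠ g(z)`, `g(c) = 0 ≠ f(c)`, `f(a) = −g(a) ≠ 0`, contradicting the
three weak signs (`SepThreeK.exists_splittable_of_signs`, abstract, any real vector space).
Consequence (parts `KPiece`, `KAssembly`): the 3-d engine with fibres needs neither the grid nor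
the fat-letter cancellation of the fibre-free proof.
-/

noncomputable section

open Set

namespace Summit.KontsevichZagierPeriods.ArrangementNormalForm.JanusBands

open Literature.NumberTheory.Transcendental

namespace SepThreeK

section Abstract

variable {V : Type*}

/-- **Three weak signs are contradictory.** If `f`, `g`, `f + g` have weak constant signs on `K`
and there are `z, a, c ∈ K` with `f z = 0 ≠ g z`, `g c = 0 ≠ f c`, `(f + g) a = 0 ≠ f a`:
contradiction. -/
theorem signs_absurd {K : Set V} {f g : V → ℝ}
    (hf : (∀ w ∈ K, 0 ≤ f w) ∨ (∀ w ∈ K, f w ≤ 0))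
    (hg : (∀ w ∈ K, 0 ≤ g w) ∨ (∀ w ∈ K, g w ≤ 0))
    (hh : (∀ w ∈ K, 0 ≤ f w + g w) ∨ (∀ w ∈ K, f w + g w ≤ 0))
    {z a c : V} (hz : z ∈ K) (ha : a ∈ K) (hc : c ∈ K)
    (hfz : f z = 0) (hgz : g z ≠ 0) (hgc : g c = 0) (hfc : f c ≠ 0) (hha : f a + g a = 0)
    (hfa : f a ≠ 0) : False := by
  rcases hf with hf | hf
  · have hfa' : 0 < f a := (hf a ha).lt_of_ne' hfa
    have hfc' : 0 < f c := (hf c hc).lt_of_ne' hfc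
    rcases hg with hg | hg
    · linarith [hg a ha]
    · have hgz' : g z < 0 := (hg z hz).lt_of_ne hgz
      rcases hh with hh | hh
      · linarith [hh z hz]
      · linarith [hh c hc]
  · have hfa' : f a < 0 := (hf a ha).lt_of_ne hfa
    have hfc' : f c < 0 := (hf c hc).lt_of_ne hfc
    rcases hg with hg | hg
    · have hgz' : 0 < g z := (hg z hz).lt_of_ne' hgz
      rcases hh with hh | hh
      · linarith [hh c hc]
      · linarith [hh z hz]
    · linarith [hg a ha]

/-- **Splittable pairs exist** (abstract form). `K` a set, `Y, Λ_i : V → ℝ` ("`y`" and the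
poles), `H_i = {Y = Λ_i}`, `S ⊆ act` index predicates, `D` a "distinct" relation detected
pointwise (`hD`), and every difference `Λ_i − Λ_j` of a `D`-pair of `act`-poles of weak constant
sign on `K` (`hsign`). If `S` contains a `D`-pair, some `D`-pair `(i, i')` of `S` is splittable:
`H_i ∩ H_{i'} ∩ K ⊆ H_j` for all `j ∈ S`. -/
theorem exists_splittable_of_signs {ι : Type*} [Finite ι] (S act : ι → Prop) (D : ι → ι → Prop)
    (K : Set V) (Y : V → ℝ) (Λ : ι → V → ℝ) (hS : ∀ i, S i → act i)
    (hD : ∀ i j, ∀ z ∈ K, Y z = Λ i z → Y z ≠ Λ j z → D i j)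
    (hsign : ∀ i j, act i → act j → D i j →
      (∀ w ∈ K, 0 ≤ Λ i w - Λ j w) ∨ (∀ w ∈ K, Λ i w - Λ j w ≤ 0))
    (hex : ∃ i i', S i ∧ S i' ∧ D i i') :
    ∃ i i', S i ∧ S i' ∧ D i i' ∧
      ∀ z ∈ K, Y z = Λ i z → Y z = Λ i' z → ∀ j, S j → Y z = Λ j z := by
  classical
  -- a `D`-pair of `S` with minimal contact
  set Pairs : Set (ι × ι) := {q | S q.1 ∧ S q.2 ∧ D q.1 q.2} with hPairs
  set T : ι × ι → Set V := fun q => {z ∈ K | Y z = Λ q.1 z ∧ Y z = Λ q.2 z} with hT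
  have hfin : Pairs.Finite := Set.toFinite _
  have hne : Pairs.Nonempty := by
    obtain ⟨i, i', hi, hi', hD'⟩ := hex
    exact ⟨(i, i'), hi, hi', hD'⟩
  obtain ⟨⟨i, i'⟩, ⟨hi, hi', hDii'⟩, hmin⟩ := hfin.exists_minimalFor T Pairs hne
  refine ⟨i, i', hi, hi', hDii', fun z hzK hzi hzi' j hj => ?_⟩
  by_contra hzj
  -- the pairs `(i, j)` and `(i', j)` are `D`-pairs whose contacts are not smaller
  have hmin' : ∀ i₁, S i₁ → Y z = Λ i₁ z → ∃ a ∈ K, Y a = Λ i₁ a ∧ Y a = Λ j a ∧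
      ¬ (Y a = Λ i a ∧ Y a = Λ i' a) := by
    intro i₁ hi₁ hzi₁
    have hq : (i₁, j) ∈ Pairs := ⟨hi₁, hj, hD i₁ j z hzK hzi₁ hzj⟩
    by_contra hall
    push Not at hall
    have hsub : T (i₁, j) ≤ T (i, i') := fun a ha => ⟨ha.1, hall a ha.1 ha.2.1 ha.2.2⟩
    have heq := hmin hq hsub
    exact hzj (heq ⟨hzK, hzi, hzi'⟩).2.2
  obtain ⟨a, haK, hai, haj, ha'⟩ := hmin' i hi hzi
  obtain ⟨c, hcK, hci', hcj, hc'⟩ := hmin' i' hi' hzi'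
  have hai' : Y a ≠ Λ i' a := fun h => ha' ⟨hai, h⟩
  have hci : Y c ≠ Λ i c := fun h => hc' ⟨h, hci'⟩
  -- the three signs
  have h1 := hsign i i' (hS i hi) (hS i' hi') hDii'
  have h2 := hsign i' j (hS i' hi') (hS j hj) (hD i' j z hzK hzi' hzj)
  have h3 := hsign i j (hS i hi) (hS j hj) (hD i j z hzK hzi hzj)
  have h3' : (∀ w ∈ K, 0 ≤ (Λ i w - Λ i' w) + (Λ i' w - Λ j w)) ∨
      (∀ w ∈ K, (Λ i w - Λ i' w) + (Λ i' w - Λ j w) ≤ 0) := by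
    rcases h3 with h3 | h3
    · exact Or.inl fun w hw => by linarith [h3 w hw]
    · exact Or.inr fun w hw => by linarith [h3 w hw]
  refine signs_absurd (f := fun w => Λ i w - Λ i' w) (g := fun w => Λ i' w - Λ j w) h1 h2 h3'
    hzK haK hcK ?_ ?_ ?_ ?_ ?_ ?_
  · show Λ i z - Λ i' z = 0
    rw [← hzi, ← hzi', sub_self]
  · show Λ i' z - Λ j z ≠ 0
    rw [← hzi']
    exact sub_ne_zero.2 hzj
  · show Λ i' c - Λ j c = 0
    rw [← hci', ← hcj, sub_self]
  · show Λ i c - Λ i' c ≠ 0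
    rw [← hci']
    exact sub_ne_zero.2 (Ne.symm hci)
  · show (Λ i a - Λ i' a) + (Λ i' a - Λ j a) = 0
    rw [← hai, ← haj]; ring
  · show Λ i a - Λ i' a ≠ 0
    rw [← hai]
    exact sub_ne_zero.2 hai'

end Abstract

section Engine

open SeparatePos SepThree

variable {b k : ℕ}

/-- **A function affine along segments which does not vanish on a convex set has a constant
sign there.** -/
theorem sign_of_convex {σ : Set (Fin (b + 1 + k) → ℝ)} (hσ : Convex ℝ σ)
    {f : (Fin (b + 1 + k) → ℝ) → ℝ}
    (hf : ∀ (x y : Fin (b + 1 + k) → ℝ) {α β : ℝ}, α + β = 1 → f (α • x + β • y) = α * f x + β * f y)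
    (h0 : ∀ w ∈ σ, f w ≠ 0) : (∀ w ∈ σ, 0 < f w) ∨ (∀ w ∈ σ, f w < 0) := by
  by_contra hcon
  push Not at hcon
  obtain ⟨⟨x, hx, hfx⟩, ⟨y, hy, hfy⟩⟩ := hcon
  have hfx' : f x < 0 := hfx.lt_of_ne (h0 x hx)
  have hfy' : 0 < f y := hfy.lt_of_ne' (h0 y hy)
  -- the zero of `f` on the segment `[x, y]`
  set t : ℝ := f y / (f y - f x) with ht
  have hd : 0 < f y - f x := by linarith
  have ht0 : 0 ≤ t := div_nonneg hfy'.le hd.le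
  have ht1 : t ≤ 1 := by rw [ht, div_le_one hd]; linarith
  have hmem : t • x + (1 - t) • y ∈ σ := hσ hx hy ht0 (by linarith) (by ring)
  refine h0 _ hmem ?_
  rw [hf x y (by ring), ht]
  field_simp
  ring

/-- **The resultant of two poles under the ratio condition has a weak constant sign on the closed
cell.** If the pole `y = λ'(x')` does not vanish on the cell `σ = gDom …` and
`|y − λ'| ≤ C |λ − λ'|` on `σ`, then `λ − λ'` does not vanish on `σ`, hence (convexity) has a
constant sign on `σ` and a weak constant sign on `closure σ`. -/
theorem sign_of_ratio {m' : ℕ} (M : Fin m' → (Fin (b + 1) → ℚ) × ℚ)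
    (lo hi : Fin k → Fin k ⊕ ((Fin (b + 1) → ℚ) × ℚ)) (c c' : (Fin b → ℚ) × ℚ)
    (hpole : ∀ z ∈ gDom b k m' M lo hi, z (Fin.castAdd k (Fin.last b)) - affB b k c' z ≠ 0)
    {C : ℝ} (hC : ∀ z ∈ gDom b k m' M lo hi, |z (Fin.castAdd k (Fin.last b)) - affB b k c' z| ≤
      C * |affB b k c z - affB b k c' z|) :
    (∀ w ∈ closure (gDom b k m' M lo hi), 0 ≤ affB b k c w - affB b k c' w) ∨
      (∀ w ∈ closure (gDom b k m' M lo hi), affB b k c w - affB b k c' w ≤ 0) := by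
  have h0 : ∀ w ∈ gDom b k m' M lo hi, affB b k c w - affB b k c' w ≠ 0 := fun w hw h =>
    hpole w hw (abs_eq_zero.mp (le_antisymm (by simpa [h] using hC w hw) (abs_nonneg _)))
  have hcont : Continuous fun w : Fin (b + 1 + k) → ℝ => affB b k c w - affB b k c' w :=
    (wall_continuous_affB c).sub (wall_continuous_affB c')
  rcases sign_of_convex (convex_gDom m' M lo hi) (f := fun w => affB b k c w - affB b k c' w)
    (fun x y α β hαβ => by simp only [affB_combo c x y hαβ, affB_combo c' x y hαβ]; ring) h0 with
    h | h
  · exact Or.inl fun w hw => closure_minimal (fun w hw => show w ∈ {w | 0 ≤ affB b k c w -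
      affB b k c' w} from (h w hw).le) (isClosed_le continuous_const hcont) hw
  · exact Or.inr fun w hw => closure_minimal (fun w hw => show w ∈ {w | affB b k c w -
      affB b k c' w ≤ 0} from (h w hw).le) (isClosed_le hcont continuous_const) hw

/-- **Ratio conditions make every family of poles unblocked**: the hypothesis `hunb` of the
contact-aware engine `SepThree.sepC_induction`, for ANY cell `gDom b k …` whose `act`-poles do
not vanish on the cell and satisfy the ratio condition pairwise; see the module docstring. -/
theorem hunb_of_ratio {m' r : ℕ} (M : Fin m' → (Fin (b + 1) → ℚ) × ℚ)
    (lo hi : Fin k → Fin k ⊕ ((Fin (b + 1) → ℚ) × ℚ)) (lam : Fin r → (Fin b → ℚ) × ℚ)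
    (act : Fin r → Prop)
    (hpole : ∀ j, act j → ∀ z ∈ gDom b k m' M lo hi,
      z (Fin.castAdd k (Fin.last b)) - affB b k (lam j) z ≠ 0)
    (hrat : ∀ j j', act j → act j' → lam j ≠ lam j' →
      ∃ C, ∀ z ∈ gDom b k m' M lo hi, |z (Fin.castAdd k (Fin.last b)) - affB b k (lam j') z| ≤
        C * |affB b k (lam j) z - affB b k (lam j') z|) :
    ∀ S : Fin r → Prop, (∀ j, S j → act j) → (∃ j j', S j ∧ S j' ∧ lam j ≠ lam j') →
      ∃ j j', S j ∧ S j' ∧ lam j ≠ lam j' ∧ ∀ z ∈ closure (gDom b k m' M lo hi),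
        z (Fin.castAdd k (Fin.last b)) = affB b k (lam j) z →
        z (Fin.castAdd k (Fin.last b)) = affB b k (lam j') z →
        ∀ i, S i → z (Fin.castAdd k (Fin.last b)) = affB b k (lam i) z := by
  intro S hS hex
  exact exists_splittable_of_signs S act (fun i j => lam i ≠ lam j)
    (closure (gDom b k m' M lo hi)) (fun z => z (Fin.castAdd k (Fin.last b)))
    (fun i z => affB b k (lam i) z) hS
    (fun i j z _ hzi hzj h => hzj (by rw [← h]; exact hzi))
    (fun i j hai haj hij => by
      obtain ⟨C, hC⟩ := hrat i j hai haj hij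
      exact sign_of_ratio M lo hi (lam i) (lam j) (hpole j haj) hC)
    hex

end Engine

end SepThreeK

open SepThreeK SeparatePos in
/-- **Ratio conditions make every family of poles unblocked** (registered sub-goal of
`stub_separateHigh`, part `KUnblocked`; literal form of `SepThreeK.hunb_of_ratio`): the
hypothesis `hunb` of the contact-aware engine `SepThree.sepC_induction` in every base dimension
`b + 1` with `k` fibres, from the non-vanishing of the `act`-poles on the cell and the pairwise
ratio condition alone. -/
theorem separateThreeK_unblocked (b k m' r : ℕ) (M : Fin m' → (Fin (b + 1) → ℚ) × ℚ) (lo hi : Fin k → Fin k ⊕ ((Fin (b + 1) → ℚ) × ℚ)) (lam : Fin r → (Fin b → ℚ) × ℚ) (act : Fin r → Prop) (hpole : ∀ j, act j → ∀ z ∈ SeparatePos.gDom b k m' M lo hi, z (Fin.castAdd k (Fin.last b)) - SeparatePos.affB b k (lam j) z ≠ 0) (hrat : ∀ j j', act j → act j' → lam j ≠ lam j' → ∃ C, ∀ z ∈ SeparatePos.gDom b k m' M lo hi, |z (Fin.castAdd k (Fin.last b)) - SeparatePos.affB b k (lam j') z| ≤ C * |SeparatePos.affB b k (lam j) z - SeparatePos.affB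 b k (lam j') z|) (S : Fin r → Prop) (hS : ∀ j, S j → act j) (hex : ∃ j j', S j ∧ S j' ∧ lam j ≠ lam j') : ∃ j j', S j ∧ S j' ∧ lam j ≠ lam j' ∧ ∀ z ∈ closure (SeparatePos.gDom b k m' M lo hi), z (Fin.castAdd k (Fin.last b)) = SeparatePos.affB b k (lam j) z → z (Fin.castAdd k (Fin.last b)) = SeparatePos.affB b k (lam j') z → ∀ i, S i → z (Fin.castAdd k (Fin.last b)) = SeparatePos.affB b k (lam i) z :=
  hunb_of_ratio M lo hi lam act hpole hrat S hS hex

end Summit.KontsevichZagierPeriods.ArrangementNormalForm.JanusBands
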